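import Mathlib.Tactic.FieldSimp
import Literature.NumberTheory.EllipticCurves.IsogenyRamification
import Literature.NumberTheory.EllipticCurves.IsogenyDeterminantProofs
import HarnessLib

/-!
# `End_{K̄}(E)` is commutative in characteristic `0` (Silverman, *AEC*, Cor. III.5.6(c))

Topic `NumberTheory/EllipticCurves` (trunk T-ELLARITH, notion `cm_endomorphisms_isogeny`). Sibling
*proofs* file of the prelude `Literature.NumberTheory.EllipticCurves.Isogeny` (D-0014 append
protocol; every declaration here is a theorem): it **discharges the named fact
`WeierstrassCurve.geomEndRing_comm`** —

* `WeierstrassCurve.geomEndRing_comm_holds : W.geomEndRing_comm`: for an elliptic curve `E = W`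
  over a field `K` of characteristic `0`, any two elements of the geometric endomorphism ring
  `W.geomEndRing = End_{K̄}(E)` (the subring of `AddMonoid.End E(K̄)` generated by the *algebraic*
  additive endomorphisms) commute,

which is Silverman, *The Arithmetic of Elliptic Curves*, 2nd ed., Cor. III.5.6(c): *"If
`char(K) = 0`, then `End(E)` is a commutative ring"* (so that `End(E)` is `ℤ` or an order in an
imaginary quadratic field, Cor. III.9.4 and Remark III.9.4.1). On the way:

* `WeierstrassCurve.Isogeny.comp_comm : φ.comp ψ = ψ.comp φ` for isogenies `φ, ψ : E → E` over `K`
  (`[CharZero K]`), and `Isogeny.comp_apply_comm`, `IsAlgebraicOn.comp_comm`.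

## The printed proof and the proof given here

Silverman proves III.5.6 with the invariant differential `ω`: `φ^* ω = a_φ ω` with `a_φ ∈ K̄`
(`div ω = 0`), `φ ↦ a_φ` is a ring homomorphism `End(E) → K̄` (additivity being Thm. III.5.2, the
linearisation of the group law) whose kernel is the set of inseparable endomorphisms
(Prop. II.4.2(c)); in characteristic `0` every endomorphism is separable, so `End(E) ↪ K̄` is
commutative. Neither differentials on curves nor II.4.2(c) are available in Mathlib or the tree.
The proof given here replaces the invariant differential by **formal linearisation at `O`**
(the fixed point `O` of all endomorphisms, with uniformiser `t = x/y`, Silverman IV.§1), using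
only the valuation `v_O` of `K̄(E)` and the pull-backs `φ^* : K̄(E) → K̄(E)` of the tree:

1. *Local centraliser lemma* (`Literature.NumberTheory.EllipticCurves.LocalLinearization`, pure
   valuation algebra for a valued field `(F, v)` trivial on a subfield `k` of residue
   characteristic `0`, with residue field `k` and a uniformiser `t`): let `γ₁, γ₂, δ` be
   `k`-algebra endomorphisms of `F` which are *contracting* (`v (γ u) ≤ v u` on the valuation
   ring), with `γᵢ ∘ δ = δ ∘ γᵢ`, `δ t ≡ 2t (mod 𝔪²)` and `γ₁ t ≡ γ₂ t (mod 𝔪²)`. Then `γ₁ = γ₂`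
   (`map_t_eq_of_commute`, `algHom_ext_of_map_t_eq`). Indeed if `γ₂ t - γ₁ t ≡ c tᵐ (mod 𝔪ᵐ⁺¹)`,
   `m ≥ 2`, write `δ t = 2t + t² q(t) + r` with `q ∈ k[X]`, `r ∈ 𝔪ᵐ⁺¹` (`k[t]` is dense);
   comparing `γᵢ (δ t) = δ (γᵢ t)` for `i = 1, 2` gives `2 c tᵐ ≡ 2ᵐ c tᵐ (mod 𝔪ᵐ⁺¹)`, so `c = 0`
   as `2ᵐ ≠ 2`; hence `γ₁ t = γ₂ t`, and a contracting `k`-endomorphism is determined by its value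
   on `t` (density of `k[t]` and continuity). This is the formal-group statement "in
   characteristic `0` a homomorphism of formal groups is determined by its linear term"
   (Silverman, *AEC*, IV.§2–§5, via the formal logarithm), in the form "the centraliser of
   `t ↦ 2t + O(t²)` under substitution is abelian" (Kœnigs–Schröder linearisation), which needs
   only one-variable expansions.
2. *The multiplier of `[2]` at `O` is `2`* (`placeVal_zero_pullbackHom_two_sub_le`:
   `[2]^* t ≡ 2t (mod 𝔪_O²)`): by the doubling formula (*AEC* III.2.3(d)) over the field `K̄(E)`
   — the tree's `map_pullbackHom_zsmul_genericPoint`: `([2]^* x, [2]^* y) = (x, y) + (x, y)` in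
   `E(K̄(E))` — and `v_O x = exp 2`, `v_O y = exp 3`: the tangent slope is `~ 3x²/2y`,
   `x([2]P) ~ x/4`, `y([2]P) ~ y/8` (`near_addX`, `near_addY`), so `[2]^*(x/y) ~ 2·x/y`.
3. For isogenies `φ, ψ : E → E`, `(φ ∘ ψ)^* = ψ^* ∘ φ^*` and `(ψ ∘ φ)^*` are contracting
   (`v_O (χ^* u) = v_O (u) ^ {e_χ(O)}`, the tree's `Isogeny.placeVal_pullbackHom`), commute with
   `[2]^*` (isogenies are homomorphisms, so `χ ∘ [2] = [2] ∘ χ`), and both are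
   `≡ a_φ a_ψ t (mod 𝔪_O²)` on `t`; by (1) and (2) they are equal, so `φ ∘ ψ = ψ ∘ φ`
   (`Isogeny.eq_of_pullbackHom_eq`: an isogeny is determined by `φ^* x'`, `φ^* y'`).
4. An algebraic additive endomorphism of `E(K̄)` need not be defined over `K`; transported along
   `E(K̄) ≅ E_{K̄}(K̄̄)` (`K̄ → K̄̄` is a bijection and `Gal(K̄̄/K̄)` is trivial) it is an isogeny of
   `E_{K̄} = W.baseChange K̄` over `K̄` in the prelude's sense (`isAlgebraicOn_conj`), so (3) applies
   (`IsAlgebraicOn.comp_comm`); and a subring generated by pairwise commuting elements is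
   commutative (Mathlib's `Subring.isMulCommutative_closure`).

## References

* [SilvermanAEC2009] J. H. Silverman, *The Arithmetic of Elliptic Curves*, 2nd ed., GTM 106,
  Springer 2009: **Cor. III.5.6(c)** (p. 79; `lit read book:silverman2009-…` PDF p. 77),
  Cor. III.9.4 and Remark III.9.4.1 (p. 96; PDF p. 94), III.2.3(d) (duplication formula),
  IV.§1 (`z = -x/y` a uniformiser at `O`), IV.§2–§5 (homomorphisms of formal groups in
  characteristic `0`).
* G. Kœnigs, *Recherches sur les intégrales de certaines équations fonctionnelles*, Ann. Sci. ÉNS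
  (3) 1 (1884), supplément, 3–41 (formal linearisation of `z ↦ az + O(z²)`, `a` not a root of
  unity) — the shape of step 1; not cited in any statement.

## Design

`noncomputable section`, `open scoped Classical`, one universe `u`, dot-notation extensions in
`namespace WeierstrassCurve` / `WeierstrassCurve.Isogeny` as in the sibling files; the generic
valuation algebra in `namespace Literature.NumberTheory.EllipticCurves.LocalLinearization`. No
definitions are introduced: "contracting" and "agree to leading order" (`v (g - h) < v h`) are
spelled out as hypotheses, and the transport of step 4 is stated for any additive equivalence
agreeing with Mathlib's `Affine.Point.map` along `K̄ → K̄̄`.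
-/

noncomputable section

open scoped Classical WithZero
open WithZero Polynomial

universe u

/-! ## Local linearisation: valuation algebra -/

namespace Literature.NumberTheory.EllipticCurves.LocalLinearization

variable {k : Type*} {F : Type*} [Field k] [Field F] [Algebra k F]
variable (v : Valuation F ℤᵐ⁰)

/-! ### Small lemmas in `ℤᵐ⁰` -/

omit [Algebra k F] in
/-- `x < exp n ↔ x ≤ exp (n - 1)` in `ℤᵐ⁰`. [folklore] -/
theorem lt_exp_iff_le_exp_sub_one {x : ℤᵐ⁰} (n : ℤ) : x < exp n ↔ x ≤ exp (n - 1) := by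
  have h : exp (n - 1) * exp 1 = exp n := by rw [← exp_add, sub_add_cancel]
  rw [← h]
  exact lt_mul_exp_iff_le (exp_ne_zero)

omit [Algebra k F] in
/-- `x < 1 ↔ x ≤ exp (-1)` in `ℤᵐ⁰`. [folklore] -/
theorem lt_one_iff_le_exp_neg_one {x : ℤᵐ⁰} : x < 1 ↔ x ≤ exp (-1) := by
  rw [← exp_zero, lt_exp_iff_le_exp_sub_one, zero_sub]

omit [Algebra k F] in
/-- `exp (-N) ≤ 1`. [folklore] -/
theorem exp_neg_natCast_le_one (n : ℕ) : exp (-(n : ℤ)) ≤ (1 : ℤᵐ⁰) := by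
  rw [← exp_zero, exp_le_exp]; omega

omit [Algebra k F] in
/-- **An element of `⋂ₙ 𝔪ⁿ` is zero**: if `v w ≤ exp (-N)` for all `N` then `w = 0`. [folklore] -/
theorem eq_zero_of_forall_le_exp_neg {w : F} (h : ∀ N : ℕ, v w ≤ exp (-(N : ℤ))) : w = 0 := by
  by_contra hw
  obtain ⟨N, hN⟩ := exists_exp_neg_natCast_lt ((Valuation.ne_zero_iff v).mpr hw)
  exact lt_irrefl _ (hN.trans_le (h N))

/-! ### Power differences and polynomial values -/

omit [Algebra k F] in
/-- `v (aⁿ⁺¹ - bⁿ⁺¹) ≤ v (a - b) ρⁿ` when `v a, v b ≤ ρ`. [folklore] -/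
theorem map_pow_sub_pow_le {a b : F} {ρ : ℤᵐ⁰} (ha : v a ≤ ρ) (hb : v b ≤ ρ) (n : ℕ) :
    v (a ^ (n + 1) - b ^ (n + 1)) ≤ v (a - b) * ρ ^ n := by
  induction n with
  | zero => simp
  | succ n ih =>
    have e : a ^ (n + 2) - b ^ (n + 2) = a * (a ^ (n + 1) - b ^ (n + 1)) + (a - b) * b ^ (n + 1) := by
      ring
    rw [e]
    refine Valuation.map_add_le _ ?_ ?_
    · rw [map_mul]
      calc v a * v (a ^ (n + 1) - b ^ (n + 1)) ≤ ρ * (v (a - b) * ρ ^ n) := mul_le_mul' ha ih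
        _ = v (a - b) * ρ ^ (n + 1) := by rw [mul_left_comm, ← pow_succ']
    · rw [map_mul, map_pow]
      exact mul_le_mul' le_rfl (pow_le_pow_left₀ zero_le hb _)

omit [Algebra k F] in
/-- Powers of congruent elements of `𝔪`: `a ≡ b (mod 𝔪ʲ⁺¹)` with `a ∈ 𝔪` gives
`aⁿ⁺¹ ≡ bⁿ⁺¹ (mod 𝔪ʲ⁺ⁿ⁺¹)`. [folklore] -/
theorem map_pow_sub_pow_le_exp {a b : F} (ha : v a ≤ exp (-1)) {j : ℕ}
    (hab : v (a - b) ≤ exp (-((j + 1 : ℕ) : ℤ))) (n : ℕ) :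
    v (a ^ (n + 1) - b ^ (n + 1)) ≤ exp (-((j + n + 1 : ℕ) : ℤ)) := by
  have hb : v b ≤ exp (-1) := by
    have e : b = a - (a - b) := by ring
    rw [e]
    refine Valuation.map_sub_le _ ha (hab.trans ?_)
    rw [exp_le_exp]; omega
  calc v (a ^ (n + 1) - b ^ (n + 1)) ≤ v (a - b) * exp (-1) ^ n := map_pow_sub_pow_le v ha hb n
    _ ≤ exp (-((j + 1 : ℕ) : ℤ)) * exp (-1) ^ n := mul_le_mul' hab le_rfl
    _ = exp (-((j + n + 1 : ℕ) : ℤ)) := by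
        rw [← exp_nsmul, ← exp_add]
        congr 1
        simp only [smul_neg, nsmul_eq_mul, mul_one]
        omega

variable [v.IsTrivialOn k]

/-- Values of `k`-polynomials at integral elements are integral. [folklore] -/
theorem map_aeval_le_one {a : F} (ha : v a ≤ 1) (p : k[X]) : v (aeval a p) ≤ 1 := by
  induction p using Polynomial.induction_on' with
  | add p q hp hq => rw [map_add]; exact Valuation.map_add_le _ hp hq
  | monomial n c =>
    rw [aeval_monomial, map_mul, map_pow]
    exact mul_le_one' (Valuation.IsTrivialOn.valuation_algebraMap_le_one v c) (pow_le_one' ha _)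

/-- `k`-polynomials are `1`-Lipschitz on integral elements: `v (p(a) - p(b)) ≤ v (a - b)`.
[folklore] -/
theorem map_aeval_sub_aeval_le {a b : F} (ha : v a ≤ 1) (hb : v b ≤ 1) (p : k[X]) :
    v (aeval a p - aeval b p) ≤ v (a - b) := by
  induction p using Polynomial.induction_on' with
  | add p q hp hq =>
    have e : aeval a (p + q) - aeval b (p + q) = (aeval a p - aeval b p) + (aeval a q - aeval b q) := by
      simp only [map_add]; ring
    rw [e]
    exact Valuation.map_add_le _ hp hq
  | monomial n c =>
    rw [aeval_monomial, aeval_monomial, ← mul_sub, map_mul]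
    refine (mul_le_mul' (Valuation.IsTrivialOn.valuation_algebraMap_le_one v c) le_rfl).trans ?_
    rw [one_mul]
    cases n with
    | zero => simp
    | succ n => simpa using map_pow_sub_pow_le v ha hb n

omit [v.IsTrivialOn k] in
/-- `v n = 1` for a non-zero natural number `n`, in residue characteristic `0`. [folklore] -/
theorem map_natCast_eq_one (k : Type*) [Field k] [Algebra k F] [CharZero k] (v : Valuation F ℤᵐ⁰)
    [v.IsTrivialOn k] {n : ℕ} (hn : n ≠ 0) : v (n : F) = 1 := by
  rw [show (n : F) = algebraMap k F n by rw [map_natCast]]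
  exact Valuation.IsTrivialOn.eq_one _ (Nat.cast_ne_zero.mpr hn)

variable {v} in
omit [v.IsTrivialOn k] in
/-- A *contracting* endomorphism (`v (γ u) ≤ v u` whenever `v u ≤ 1`) maps `𝔪ⁿ` into `𝔪ⁿ`.
[folklore] -/
theorem map_le_of_contracting {γ : F →ₐ[k] F} (hγ : ∀ u, v u ≤ 1 → v (γ u) ≤ v u) {u : F}
    {g : ℤᵐ⁰} (hu : v u ≤ g) (hg : g ≤ 1) : v (γ u) ≤ g :=
  (hγ u (hu.trans hg)).trans hu

/-! ### A uniformiser `t`, residues in `k`, density of `k[t]` -/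

section Local

variable {v}
variable {t : F} (ht : v t = exp (-1))
include ht

omit [v.IsTrivialOn k] in
/-- `v (tⁿ) = exp (-n)`. [folklore] -/
theorem map_t_pow (n : ℕ) : v (t ^ n) = exp (-(n : ℤ)) := by
  rw [map_pow, ht, ← exp_nsmul]
  congr 1
  simp

omit [v.IsTrivialOn k] in
/-- If `v u ≤ exp (-n)` then `u / tⁿ` is integral. [folklore] -/
theorem map_div_t_pow_le_one {u : F} {n : ℕ} (hu : v u ≤ exp (-(n : ℤ))) : v (u / t ^ n) ≤ 1 := by
  have htn : v (t ^ n) ≠ 0 := by rw [map_t_pow ht]; exact exp_ne_zero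
  rw [map_div₀, div_le_one₀ (pos_of_ne_zero htn), map_t_pow ht]
  exact hu

/-- A constant multiple `c tⁿ` lying in `𝔪ⁿ⁺¹` has `c = 0`. [folklore] -/
theorem const_eq_zero_of_le {c : k} {n : ℕ}
    (h : v (algebraMap k F c * t ^ n) ≤ exp (-((n + 1 : ℕ) : ℤ))) : c = 0 := by
  by_contra hc
  rw [map_mul, Valuation.IsTrivialOn.eq_one c hc, one_mul, map_t_pow ht, exp_le_exp] at h
  push_cast at h
  omega

variable (hres : ∀ u : F, v u ≤ 1 → ∃ c : k, v (u - algebraMap k F c) < 1)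
include hres

omit [v.IsTrivialOn k] in
/-- **Residues**: an element of `𝔪ⁿ` is a constant multiple of `tⁿ` modulo `𝔪ⁿ⁺¹` (the residue
field is `k`). [folklore] -/
theorem exists_sub_const_mul_pow_le {u : F} {n : ℕ} (hu : v u ≤ exp (-(n : ℤ))) :
    ∃ c : k, v (u - algebraMap k F c * t ^ n) ≤ exp (-((n + 1 : ℕ) : ℤ)) := by
  obtain ⟨c, hc⟩ := hres _ (map_div_t_pow_le_one ht hu)
  refine ⟨c, ?_⟩
  have htn0 : t ^ n ≠ 0 := pow_ne_zero _ (by rintro rfl; rw [map_zero] at ht; exact exp_ne_zero ht.symm)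
  have e : u - algebraMap k F c * t ^ n = (u / t ^ n - algebraMap k F c) * t ^ n := by
    rw [sub_mul, div_mul_cancel₀ _ htn0]
  rw [e, map_mul, map_t_pow ht]
  rw [lt_one_iff_le_exp_neg_one] at hc
  calc v (u / t ^ n - algebraMap k F c) * exp (-(n : ℤ)) ≤ exp (-1) * exp (-(n : ℤ)) :=
        mul_le_mul' hc le_rfl
    _ = exp (-((n + 1 : ℕ) : ℤ)) := by rw [← exp_add]; congr 1; push_cast; ring

omit [v.IsTrivialOn k] in
/-- **`k[t]` is dense in the valuation ring**: every integral `u` is congruent to a polynomial in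
`t` with coefficients in `k` modulo `𝔪ᴺ`. [folklore] -/
theorem exists_aeval_approx (N : ℕ) {u : F} (hu : v u ≤ 1) :
    ∃ p : k[X], v (u - aeval t p) ≤ exp (-(N : ℤ)) := by
  induction N generalizing u with
  | zero => exact ⟨0, by simpa using hu⟩
  | succ N ih =>
    obtain ⟨c, hc⟩ := hres u hu
    rw [lt_one_iff_le_exp_neg_one] at hc
    have h1 : v ((u - algebraMap k F c) / t ^ 1) ≤ 1 :=
      map_div_t_pow_le_one ht (by simpa using hc)
    obtain ⟨p, hp⟩ := ih h1
    refine ⟨C c + X * p, ?_⟩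
    have e : u - aeval t (C c + X * p) = t * ((u - algebraMap k F c) / t ^ 1 - aeval t p) := by
      rw [pow_one, mul_sub, mul_div_cancel₀ _ (by rintro rfl; rw [map_zero] at ht; exact exp_ne_zero ht.symm), map_add, map_mul,
        aeval_C, aeval_X]
      ring
    rw [e, map_mul, ht]
    calc exp (-1) * v ((u - algebraMap k F c) / t ^ 1 - aeval t p) ≤ exp (-1) * exp (-(N : ℤ)) :=
          mul_le_mul' le_rfl hp
      _ = exp (-((N + 1 : ℕ) : ℤ)) := by rw [← exp_add]; congr 1; push_cast; ring

/-! ### Contracting `k`-algebra endomorphisms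

A `k`-algebra endomorphism `γ` of `F` is *contracting* if `v (γ u) ≤ v u` whenever `v u ≤ 1`
(e.g. `φ^*` for a map of curves fixing the centre of `v`: `v (φ^* u) = v (u) ^ e`); this is kept
as the explicit hypothesis `∀ u, v u ≤ 1 → v (γ u) ≤ v u`. -/

omit [v.IsTrivialOn k] in
/-- **A contracting endomorphism is determined by the image of the uniformiser** (density of
`k[t]` and continuity). [folklore] -/
theorem algHom_ext_of_map_t_eq {γ₁ γ₂ : F →ₐ[k] F} (h₁ : ∀ u, v u ≤ 1 → v (γ₁ u) ≤ v u)
    (h₂ : ∀ u, v u ≤ 1 → v (γ₂ u) ≤ v u) (h : γ₁ t = γ₂ t) : γ₁ = γ₂ := by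
  -- first on integral elements
  have hint : ∀ u : F, v u ≤ 1 → γ₁ u = γ₂ u := by
    intro u hu
    rw [← sub_eq_zero]
    refine eq_zero_of_forall_le_exp_neg v fun N ↦ ?_
    obtain ⟨p, hp⟩ := exists_aeval_approx ht hres N hu
    have e : γ₁ u - γ₂ u = γ₁ (u - aeval t p) - γ₂ (u - aeval t p) := by
      rw [map_sub, map_sub, ← aeval_algHom_apply, ← aeval_algHom_apply, h]; ring
    rw [e]
    exact Valuation.map_sub_le _ (map_le_of_contracting h₁ hp (exp_neg_natCast_le_one N))
      (map_le_of_contracting h₂ hp (exp_neg_natCast_le_one N))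
  refine AlgHom.ext fun u ↦ ?_
  by_cases hu : v u ≤ 1
  · exact hint u hu
  · have hinv : v u⁻¹ ≤ 1 := by
      rw [map_inv₀]; exact inv_le_one_of_one_le₀ (le_of_not_ge hu)
    have := hint _ hinv
    rw [map_inv₀, map_inv₀, inv_inj] at this
    exact this

/-! ### The centraliser of `t ↦ 2t + O(t²)` -/

/-- **The local centraliser lemma.** Let `γ₁, γ₂, δ` be contracting `k`-algebra endomorphisms of
`F` with `γᵢ ∘ δ = δ ∘ γᵢ`, `δ t ≡ 2 t (mod 𝔪²)` and `γ₁ t ≡ γ₂ t (mod 𝔪²)`. In residue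
characteristic `0`, `γ₁ t = γ₂ t`. (Induction on the order of agreement: if
`γ₂ t - γ₁ t ≡ c tᵐ (mod 𝔪ᵐ⁺¹)`, applying `γᵢ` to `δ t = 2t + t² q(t) + r`, `r ∈ 𝔪ᵐ⁺¹`, and
comparing with `δ (γᵢ t)` gives `2 c tᵐ ≡ 2ᵐ c tᵐ (mod 𝔪ᵐ⁺¹)`, so `c = 0` because `2ᵐ ≠ 2`.)
[folklore] -/
theorem map_t_eq_of_commute [CharZero k] {γ₁ γ₂ δ : F →ₐ[k] F}
    (h₁ : ∀ u, v u ≤ 1 → v (γ₁ u) ≤ v u) (h₂ : ∀ u, v u ≤ 1 → v (γ₂ u) ≤ v u)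
    (hδ : ∀ u, v u ≤ 1 → v (δ u) ≤ v u)
    (hc₁ : ∀ u, γ₁ (δ u) = δ (γ₁ u)) (hc₂ : ∀ u, γ₂ (δ u) = δ (γ₂ u))
    (hδt : v (δ t - 2 * t) ≤ exp (-2)) (h12 : v (γ₁ t - γ₂ t) ≤ exp (-2)) :
    γ₁ t = γ₂ t := by
  have ht0 : t ≠ 0 := (by rintro rfl; rw [map_zero] at ht; exact exp_ne_zero ht.symm)
  have hle1 : (exp (-1) : ℤᵐ⁰) ≤ 1 := by rw [← exp_zero, exp_le_exp]; omega
  have ht1 : v t ≤ 1 := ht.le.trans hle1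
  have h2 : v (2 : F) = 1 := map_natCast_eq_one k v two_ne_zero
  have hγ₁t : v (γ₁ t) ≤ exp (-1) := (h₁ t ht1).trans ht.le
  have hγ₂t : v (γ₂ t) ≤ exp (-1) := (h₂ t ht1).trans ht.le
  have hδt' : v (δ t) ≤ exp (-1) := by
    have e : δ t = (δ t - 2 * t) + 2 * t := by ring
    rw [e]
    refine Valuation.map_add_le _ (hδt.trans ?_) (by rw [map_mul, h2, one_mul, ht])
    rw [exp_le_exp]; omega
  -- the induction: `v (γ₂ t - γ₁ t) ≤ exp (-(n+2))` for all `n`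
  suffices key : ∀ n : ℕ, v (γ₂ t - γ₁ t) ≤ exp (-((n + 2 : ℕ) : ℤ)) by
    have h0 : γ₂ t - γ₁ t = 0 := eq_zero_of_forall_le_exp_neg v fun N ↦ (key N).trans (by
      rw [exp_le_exp]; omega)
    exact (sub_eq_zero.mp h0).symm
  intro n
  induction n with
  | zero => rw [Valuation.map_sub_swap]; simpa using h12
  | succ n ih =>
    -- notation: `m = n + 2`, `d = γ₂ t - γ₁ t ∈ 𝔪ᵐ`, `d ≡ T = c tᵐ (mod 𝔪ᵐ⁺¹)`
    obtain ⟨d, hd⟩ : ∃ d, γ₂ t - γ₁ t = d := ⟨_, rfl⟩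
    rw [hd] at ih ⊢
    have hb : γ₂ t = γ₁ t + d := by rw [← hd]; ring
    obtain ⟨c, hc⟩ := exists_sub_const_mul_pow_le ht hres ih
    obtain ⟨T, hT⟩ : ∃ T, algebraMap k F c * t ^ (n + 2) = T := ⟨_, rfl⟩
    rw [hT] at hc
    -- `δ t = p(t) + r` with `p = 2X + X² q`, `r ∈ 𝔪ᵐ⁺¹`
    have hs : v ((δ t - 2 * t) / t ^ 2) ≤ 1 := map_div_t_pow_le_one ht (by simpa using hδt)
    obtain ⟨q, hq⟩ := exists_aeval_approx ht hres (n + 1) hs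
    obtain ⟨p, hp_def⟩ : ∃ p : k[X], p = 2 * X + X ^ 2 * q := ⟨_, rfl⟩
    have hp : ∀ a : F, aeval a p = 2 * a + a ^ 2 * aeval a q := by
      intro a; rw [hp_def]; simp only [map_add, map_mul, map_pow, aeval_X, map_ofNat]
    obtain ⟨r, hr_def⟩ : ∃ r, δ t - aeval t p = r := ⟨_, rfl⟩
    have eδ : δ t = aeval t p + r := by rw [← hr_def]; ring
    have hr : v r ≤ exp (-((n + 2 + 1 : ℕ) : ℤ)) := by
      have e : r = t ^ 2 * ((δ t - 2 * t) / t ^ 2 - aeval t q) := by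
        rw [← hr_def, hp, mul_sub, mul_div_cancel₀ _ (pow_ne_zero _ ht0)]; ring
      rw [e, map_mul, map_t_pow ht]
      calc exp (-((2 : ℕ) : ℤ)) * v ((δ t - 2 * t) / t ^ 2 - aeval t q)
          ≤ exp (-((2 : ℕ) : ℤ)) * exp (-((n + 1 : ℕ) : ℤ)) := mul_le_mul' le_rfl hq
        _ = exp (-((n + 2 + 1 : ℕ) : ℤ)) := by rw [← exp_add]; congr 1; omega
    -- (A) `γ₂ (δ t) - γ₁ (δ t) ≡ 2 d (mod 𝔪ᵐ⁺¹)`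
    have hA : v (γ₂ (δ t) - γ₁ (δ t) - 2 * d) ≤ exp (-((n + 2 + 1 : ℕ) : ℤ)) := by
      have e : γ₂ (δ t) - γ₁ (δ t) - 2 * d =
          ((γ₁ t + d) ^ 2 * (aeval (γ₁ t + d) q - aeval (γ₁ t) q) +
            d * (2 * γ₁ t + d) * aeval (γ₁ t) q) + (γ₂ r - γ₁ r) := by
        have e₂ : γ₂ (δ t) = aeval (γ₂ t) p + γ₂ r := by rw [eδ, map_add, aeval_algHom_apply]
        have e₁ : γ₁ (δ t) = aeval (γ₁ t) p + γ₁ r := by rw [eδ, map_add, aeval_algHom_apply]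
        rw [e₂, e₁, hb, hp, hp]
        ring
      rw [e]
      have hγd : v (γ₁ t + d) ≤ exp (-1) := by rw [← hb]; exact hγ₂t
      refine Valuation.map_add_le _ (Valuation.map_add_le _ ?_ ?_) ?_
      · rw [map_mul, map_pow]
        have hlip : v (aeval (γ₁ t + d) q - aeval (γ₁ t) q) ≤ exp (-((n + 2 : ℕ) : ℤ)) := by
          refine (map_aeval_sub_aeval_le v (hγd.trans hle1) (hγ₁t.trans hle1) q).trans ?_
          rw [add_sub_cancel_left]; exact ih
        calc v (γ₁ t + d) ^ 2 * v (aeval (γ₁ t + d) q - aeval (γ₁ t) q)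
            ≤ exp (-1) ^ 2 * exp (-((n + 2 : ℕ) : ℤ)) :=
              mul_le_mul' (pow_le_pow_left₀ zero_le hγd 2) hlip
          _ ≤ exp (-((n + 2 + 1 : ℕ) : ℤ)) := by
              rw [← exp_nsmul, ← exp_add, exp_le_exp]
              simp only [smul_neg, nsmul_eq_mul, mul_one]
              omega
      · rw [map_mul, map_mul]
        have h2a : v (2 * γ₁ t + d) ≤ exp (-1) :=
          Valuation.map_add_le _ (by rw [map_mul, h2, one_mul]; exact hγ₁t)
            (ih.trans (by rw [exp_le_exp]; omega))
        calc v d * v (2 * γ₁ t + d) * v (aeval (γ₁ t) q)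
            ≤ exp (-((n + 2 : ℕ) : ℤ)) * exp (-1) * 1 :=
              mul_le_mul' (mul_le_mul' ih h2a) (map_aeval_le_one v (hγ₁t.trans hle1) q)
          _ = exp (-((n + 2 + 1 : ℕ) : ℤ)) := by rw [mul_one, ← exp_add]; congr 1
      · exact Valuation.map_sub_le _ (map_le_of_contracting h₂ hr (exp_neg_natCast_le_one _))
          (map_le_of_contracting h₁ hr (exp_neg_natCast_le_one _))
    -- (B) `δ (γ₂ t) - δ (γ₁ t) = δ d ≡ 2ᵐ T (mod 𝔪ᵐ⁺¹)`
    have hB : v (δ (γ₂ t) - δ (γ₁ t) - 2 ^ (n + 2) * T) ≤ exp (-((n + 2 + 1 : ℕ) : ℤ)) := by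
      have e : δ (γ₂ t) - δ (γ₁ t) - 2 ^ (n + 2) * T =
          algebraMap k F c * ((δ t) ^ (n + 2) - (2 * t) ^ (n + 2)) + δ (d - T) := by
        rw [← map_sub, hd, show δ d = δ (T + (d - T)) by rw [add_sub_cancel], map_add, ← hT]
        simp only [map_mul, map_pow, AlgHom.commutes]
        ring
      rw [e]
      refine Valuation.map_add_le _ ?_ ?_
      · rw [map_mul]
        refine mul_le_of_le_one_of_le (Valuation.IsTrivialOn.valuation_algebraMap_le_one v c) ?_
        refine (map_pow_sub_pow_le_exp (v := v) hδt' (j := 1) (by simpa using hδt) (n + 1)).trans ?_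
        rw [exp_le_exp]; omega
      · exact map_le_of_contracting hδ hc (exp_neg_natCast_le_one _)
    -- compare the two sides using `γᵢ ∘ δ = δ ∘ γᵢ`: `(2 - 2ᵐ) c tᵐ ∈ 𝔪ᵐ⁺¹`
    have hAB : γ₂ (δ t) - γ₁ (δ t) = δ (γ₂ t) - δ (γ₁ t) := by rw [hc₁, hc₂]
    have hfinal : v (algebraMap k F ((2 - 2 ^ (n + 2)) * c) * t ^ (n + 2)) ≤
        exp (-((n + 2 + 1 : ℕ) : ℤ)) := by
      have e : algebraMap k F ((2 - 2 ^ (n + 2)) * c) * t ^ (n + 2) =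
          2 * (T - d) - (γ₂ (δ t) - γ₁ (δ t) - 2 * d) +
            (δ (γ₂ t) - δ (γ₁ t) - 2 ^ (n + 2) * T) := by
        rw [hAB, map_mul, mul_assoc, hT]
        simp only [map_sub, map_pow, map_ofNat]
        ring
      rw [e]
      refine Valuation.map_add_le _ (Valuation.map_sub_le _ ?_ hA) hB
      rw [map_mul, h2, one_mul, Valuation.map_sub_swap]
      exact hc
    have hc0 : c = 0 := by
      rcases mul_eq_zero.mp (const_eq_zero_of_le ht hfinal) with h | h
      · exfalso
        have h' : ((2 ^ (n + 2) : ℕ) : k) = ((2 : ℕ) : k) := by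
          push_cast; exact (sub_eq_zero.mp h).symm
        have h'' : 2 ^ (n + 2) = 2 := Nat.cast_injective h'
        have : 4 ≤ 2 ^ (n + 2) :=
          (Nat.pow_le_pow_right (by norm_num) (by omega : 2 ≤ n + 2)).trans_eq' (by norm_num)
        omega
      · exact h
    -- conclude: `T = 0`, so `d ∈ 𝔪ᵐ⁺¹`
    have hT0 : T = 0 := by rw [← hT, hc0, map_zero, zero_mul]
    rw [hT0, sub_zero] at hc
    exact hc

end Local

/-! ### Leading terms: `g ~ h` iff `v (g - h) < v h`

`v (g - h) < v h` says that `g = h (1 + ε)` with `v ε < 1`; it is preserved by products,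
quotients, powers, and by adding terms of smaller valuation. -/

section Near

variable {v}
variable {g g₁ g₂ h h₁ h₂ l e c₁ c₂ : F}

omit [Algebra k F] [v.IsTrivialOn k] in
/-- If `g ~ h` then `h ≠ 0`. [folklore] -/
theorem ne_zero_of_near (hg : v (g - h) < v h) : h ≠ 0 := by
  rintro rfl
  rw [map_zero] at hg
  exact not_lt_zero hg

omit [Algebra k F] [v.IsTrivialOn k] in
/-- If `g ~ h` then `g ≠ 0`. [folklore] -/
theorem left_ne_zero_of_near (hg : v (g - h) < v h) : g ≠ 0 := by
  intro h0
  have := Valuation.map_eq_of_sub_lt _ hg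
  rw [h0, map_zero] at this
  exact ne_zero_of_lt hg this.symm

omit [Algebra k F] [v.IsTrivialOn k] in
/-- `h ~ h` for `h ≠ 0`. [folklore] -/
theorem near_refl (hh : h ≠ 0) : v (h - h) < v h := by
  simpa [(Valuation.ne_zero_iff v).mpr hh] using pos_of_ne_zero ((Valuation.ne_zero_iff v).mpr hh)

omit [Algebra k F] [v.IsTrivialOn k] in
/-- `~` is symmetric. [folklore] -/
theorem near_symm (hg : v (g - h) < v h) : v (h - g) < v g := by
  rw [Valuation.map_sub_swap, Valuation.map_eq_of_sub_lt _ hg]; exact hg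

omit [Algebra k F] [v.IsTrivialOn k] in
/-- `~` is transitive. [folklore] -/
theorem near_trans (H₁ : v (g - h) < v h) (H₂ : v (h - l) < v l) : v (g - l) < v l := by
  have H₂' : v (h - l) < v h := by rwa [← Valuation.map_eq_of_sub_lt _ H₂] at H₂
  have e : g - l = (g - h) + (h - l) := by ring
  rw [e, ← Valuation.map_eq_of_sub_lt _ H₂]
  exact Valuation.map_add_lt _ H₁ H₂'

omit [Algebra k F] [v.IsTrivialOn k] in
/-- `~` is multiplicative. [folklore] -/
theorem near_mul (H₁ : v (g₁ - h₁) < v h₁) (H₂ : v (g₂ - h₂) < v h₂) :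
    v (g₁ * g₂ - h₁ * h₂) < v (h₁ * h₂) := by
  have e : g₁ * g₂ - h₁ * h₂ = (g₁ - h₁) * g₂ + h₁ * (g₂ - h₂) := by ring
  rw [e, map_mul]
  refine Valuation.map_add_lt _ ?_ ?_
  · rw [map_mul, Valuation.map_eq_of_sub_lt _ H₂]
    exact mul_lt_mul_of_pos_right H₁ (pos_of_ne_zero (ne_zero_of_lt H₂))
  · rw [map_mul]
    exact mul_lt_mul_of_pos_left H₂ (pos_of_ne_zero (ne_zero_of_lt H₁))

omit [Algebra k F] [v.IsTrivialOn k] in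
/-- `~` passes to inverses. [folklore] -/
theorem near_inv (H : v (g - h) < v h) : v (g⁻¹ - h⁻¹) < v h⁻¹ := by
  have hg0 := left_ne_zero_of_near H
  have hh0 := ne_zero_of_near H
  have e : g⁻¹ - h⁻¹ = -((g - h) * g⁻¹ * h⁻¹) := by field_simp; ring
  rw [e, Valuation.map_neg, map_mul, map_mul, map_inv₀, map_inv₀, Valuation.map_eq_of_sub_lt _ H]
  have hvh : v h ≠ 0 := ne_zero_of_lt H
  calc v (g - h) * (v h)⁻¹ * (v h)⁻¹ < v h * (v h)⁻¹ * (v h)⁻¹ :=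
        mul_lt_mul_of_pos_right (mul_lt_mul_of_pos_right H (inv_pos.mpr (pos_of_ne_zero hvh)))
          (inv_pos.mpr (pos_of_ne_zero hvh))
    _ = (v h)⁻¹ := by rw [mul_inv_cancel₀ hvh, one_mul]

omit [Algebra k F] [v.IsTrivialOn k] in
/-- `~` passes to quotients. [folklore] -/
theorem near_div (H₁ : v (g₁ - h₁) < v h₁) (H₂ : v (g₂ - h₂) < v h₂) :
    v (g₁ / g₂ - h₁ / h₂) < v (h₁ / h₂) := by
  rw [div_eq_mul_inv, div_eq_mul_inv]; exact near_mul H₁ (near_inv H₂)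

omit [Algebra k F] [v.IsTrivialOn k] in
/-- `~` passes to negatives. [folklore] -/
theorem near_neg (H : v (g - h) < v h) : v (-g - -h) < v (-h) := by
  have e : -g - -h = -(g - h) := by ring
  rw [e, Valuation.map_neg, Valuation.map_neg]
  exact H

omit [Algebra k F] [v.IsTrivialOn k] in
/-- `~` passes to powers. [folklore] -/
theorem near_pow (H : v (g - h) < v h) (n : ℕ) : v (g ^ n - h ^ n) < v (h ^ n) := by
  induction n with
  | zero => simp
  | succ n ih => rw [pow_succ, pow_succ]; exact near_mul ih H

omit [Algebra k F] [v.IsTrivialOn k] in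
/-- Adding a term of smaller valuation does not change the leading term. [folklore] -/
theorem near_add_of_lt (H : v (g - h) < v h) (he : v e < v h) : v (g + e - h) < v h := by
  have e' : g + e - h = (g - h) + e := by ring
  rw [e']
  exact Valuation.map_add_lt _ H he

omit [Algebra k F] [v.IsTrivialOn k] in
/-- Subtracting a term of smaller valuation does not change the leading term. [folklore] -/
theorem near_sub_of_lt (H : v (g - h) < v h) (he : v e < v h) : v (g - e - h) < v h := by
  rw [sub_eq_add_neg g e]; exact near_add_of_lt H (by rwa [Valuation.map_neg])

omit [Algebra k F] [v.IsTrivialOn k] in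
/-- `h + e ~ h` if `v e < v h`. [folklore] -/
theorem near_of_lt (hh : h ≠ 0) (he : v e < v h) : v (h + e - h) < v h :=
  near_add_of_lt (near_refl hh) he

omit [Algebra k F] [v.IsTrivialOn k] in
/-- Adding leading terms `c₁ h + c₂ h` with integral coefficients and `c₁ + c₂` a unit.
[folklore] -/
theorem near_add_smul (H₁ : v (g₁ - c₁ * h) < v (c₁ * h)) (H₂ : v (g₂ - c₂ * h) < v (c₂ * h))
    (hc₁ : v c₁ ≤ 1) (hc₂ : v c₂ ≤ 1) (hc : v (c₁ + c₂) = 1) :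
    v (g₁ + g₂ - (c₁ + c₂) * h) < v ((c₁ + c₂) * h) := by
  have e : g₁ + g₂ - (c₁ + c₂) * h = (g₁ - c₁ * h) + (g₂ - c₂ * h) := by ring
  rw [e, map_mul, hc, one_mul]
  rw [map_mul] at H₁ H₂
  exact Valuation.map_add_lt _ (H₁.trans_le (mul_le_of_le_one_left' hc₁))
    (H₂.trans_le (mul_le_of_le_one_left' hc₂))

end Near

end Literature.NumberTheory.EllipticCurves.LocalLinearization

namespace WeierstrassCurve

open Literature.NumberTheory.EllipticCurves.WeierstrassFunctionField
  Literature.NumberTheory.DiophantineGeometry.WeierstrassPlaceAtInfinity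
  Literature.NumberTheory.EllipticCurves.LocalLinearization geomPoints

/-! ## The doubling formula to leading order at `O`

With `v x = exp 2`, `v y = exp 3` (poles of order `2` and `3` at `O`) and integral coefficients,
the tangent slope is `L ~ 3x²/2y`, `x([2]P) = L² + a₁L - a₂ - 2x ~ x/4`,
`y([2]P) = -(L(x([2]P) - x) + y) - a₁ x([2]P) - a₃ ~ y/8`, so `(x/y)([2]P) ~ 2 · x/y`
(Silverman, *AEC*, III.2.3(d); IV.§1). Throughout, `g ~ h` is written `v (g - h) < v h`. -/

section DoublingEstimates

variable {F : Type u} [Field F] [CharZero F] (E : Affine F) (v : Valuation F ℤᵐ⁰) {x y : F}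
  (hvx : v x = exp 2) (hvy : v y = exp 3)
  (ha₁ : v E.a₁ ≤ 1) (ha₂ : v E.a₂ ≤ 1) (ha₃ : v E.a₃ ≤ 1) (ha₄ : v E.a₄ ≤ 1) (ha₆ : v E.a₆ ≤ 1)
  (hnat : ∀ {n : ℕ}, n ≠ 0 → v (n : F) = 1)

include hvx hvy ha₁ ha₃ hnat in
omit [CharZero F] in
/-- `2y + a₁ x + a₃ ~ 2y`. [folklore] -/
theorem near_sub_negY : v (y - E.negY x y - 2 * y) < v (2 * y) := by
  have hy0 : y ≠ 0 := fun h ↦ by rw [h, map_zero] at hvy; exact exp_ne_zero hvy.symm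
  have h2 : v (2 : F) = 1 := by exact_mod_cast hnat (n := 2) two_ne_zero
  have h20 : (2 : F) ≠ 0 := fun h ↦ by rw [h, map_zero] at h2; exact zero_ne_one h2
  have e : y - E.negY x y = 2 * y + (E.a₁ * x + E.a₃) := by simp only [Affine.negY]; ring
  rw [e]
  refine near_of_lt (mul_ne_zero h20 hy0) ?_
  rw [map_mul, h2, one_mul, hvy]
  refine Valuation.map_add_lt _ ?_ (ha₃.trans_lt (by rw [← exp_zero, exp_lt_exp]; norm_num))
  rw [map_mul, hvx]
  calc v E.a₁ * exp 2 ≤ 1 * exp 2 := mul_le_mul' ha₁ le_rfl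
    _ < exp 3 := by rw [one_mul, exp_lt_exp]; norm_num

include hvx hvy ha₁ ha₃ hnat in
omit [CharZero F] in
/-- The point `(x, y)` is not `2`-torsion: `y ≠ -y - a₁ x - a₃`. [folklore] -/
theorem ne_negY_of_val : y ≠ E.negY x y := fun h ↦ by
  have := left_ne_zero_of_near (near_sub_negY E v hvx hvy ha₁ ha₃ hnat)
  rw [← h, sub_self] at this
  exact this rfl

include hvx hvy ha₁ ha₂ ha₃ ha₄ hnat in
omit [CharZero F] in
/-- **The tangent slope `L = (3x² + 2a₂x + a₄ - a₁y)/(2y + a₁x + a₃) ~ 3x² / 2y`.** [folklore] -/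
theorem near_slope : v ((3 * x ^ 2 + 2 * E.a₂ * x + E.a₄ - E.a₁ * y) / (y - E.negY x y) -
    3 * x ^ 2 / (2 * y)) < v (3 * x ^ 2 / (2 * y)) := by
  have h2 : v (2 : F) = 1 := by exact_mod_cast hnat (n := 2) two_ne_zero
  have h3 : v (3 : F) = 1 := by exact_mod_cast hnat (n := 3) three_ne_zero
  have h3x2 : v (3 * x ^ 2) = exp 4 := by
    rw [map_mul, h3, one_mul, map_pow, hvx, ← exp_nsmul]; rfl
  have hnum : v (3 * x ^ 2 + 2 * E.a₂ * x + E.a₄ - E.a₁ * y - 3 * x ^ 2) < v (3 * x ^ 2) := by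
    have e : 3 * x ^ 2 + 2 * E.a₂ * x + E.a₄ - E.a₁ * y =
        3 * x ^ 2 + (2 * E.a₂ * x + E.a₄ - E.a₁ * y) := by ring
    rw [e]
    refine near_of_lt (by rw [← (Valuation.ne_zero_iff v), h3x2]; exact exp_ne_zero) ?_
    rw [h3x2]
    refine Valuation.map_sub_lt _ (Valuation.map_add_lt _ ?_
      (ha₄.trans_lt (by rw [← exp_zero, exp_lt_exp]; norm_num))) ?_
    · rw [map_mul, map_mul, h2, one_mul, hvx]
      calc v E.a₂ * exp 2 ≤ 1 * exp 2 := mul_le_mul' ha₂ le_rfl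
        _ < exp 4 := by rw [one_mul, exp_lt_exp]; norm_num
    · rw [map_mul, hvy]
      calc v E.a₁ * exp 3 ≤ 1 * exp 3 := mul_le_mul' ha₁ le_rfl
        _ < exp 4 := by rw [one_mul, exp_lt_exp]; norm_num
  exact near_div hnum (near_sub_negY E v hvx hvy ha₁ ha₃ hnat)

include hvx hvy ha₁ ha₂ ha₃ ha₄ ha₆ in
omit [CharZero F] in
/-- **The Weierstrass equation to leading order at `O`: `y² ~ x³`.** [folklore] -/
theorem near_sq_cube (hE : E.Equation x y) : v (y ^ 2 - x ^ 3) < v (x ^ 3) := by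
  have hx0 : x ≠ 0 := fun h ↦ by rw [h, map_zero] at hvx; exact exp_ne_zero hvx.symm
  rw [Affine.equation_iff] at hE
  have e : y ^ 2 = x ^ 3 + (E.a₂ * x ^ 2 + E.a₄ * x + E.a₆ - E.a₁ * x * y - E.a₃ * y) := by
    linear_combination hE
  rw [e]
  refine near_of_lt (pow_ne_zero _ hx0) ?_
  rw [map_pow, hvx, ← exp_nsmul]
  have hlt : ∀ {a : F} {m : ℤ}, v a ≤ 1 → m < 6 → v a * exp m < exp ((3 : ℕ) • (2 : ℤ)) := by
    intro a m ha hm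
    calc _ ≤ 1 * exp m := mul_le_mul' ha le_rfl
      _ < _ := by rw [one_mul, exp_lt_exp]; simpa using hm
  refine Valuation.map_sub_lt _ (Valuation.map_sub_lt _ (Valuation.map_add_lt _
    (Valuation.map_add_lt _ ?_ ?_) ?_) ?_) ?_
  · rw [map_mul, map_pow, hvx, ← exp_nsmul]; exact hlt ha₂ (by decide)
  · rw [map_mul, hvx]; exact hlt ha₄ (by norm_num)
  · simpa using hlt ha₆ (m := 0) (by norm_num)
  · rw [map_mul, map_mul, hvx, hvy, mul_assoc, ← exp_add]; exact hlt ha₁ (by norm_num)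
  · rw [map_mul, hvy]; exact hlt ha₃ (by norm_num)

include hvx hvy ha₁ ha₂ hnat in
/-- **`x([2]P) ~ x/4`**: for a slope `L ~ 3x²/2y`, `addX x x L = L² + a₁ L - a₂ - 2x ~ x/4`.
[folklore] -/
theorem near_addX {L : F} (hL : v (L - 3 * x ^ 2 / (2 * y)) < v (3 * x ^ 2 / (2 * y)))
    (heq : v (y ^ 2 - x ^ 3) < v (x ^ 3)) : v (E.addX x x L - 1 / 4 * x) < v (1 / 4 * x) := by
  have hx0 : x ≠ 0 := fun h ↦ by rw [h, map_zero] at hvx; exact exp_ne_zero hvx.symm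
  have hy0 : y ≠ 0 := fun h ↦ by rw [h, map_zero] at hvy; exact exp_ne_zero hvy.symm
  have h2 : v (2 : F) = 1 := by exact_mod_cast hnat (n := 2) two_ne_zero
  have h3 : v (3 : F) = 1 := by exact_mod_cast hnat (n := 3) three_ne_zero
  have h4 : v (4 : F) = 1 := by exact_mod_cast hnat (n := 4) (by norm_num)
  have h9 : v (9 : F) = 1 := by exact_mod_cast hnat (n := 9) (by norm_num)
  have hvL : v L = exp 1 := by
    rw [Valuation.map_eq_of_sub_lt _ hL, map_div₀, map_mul, h3, map_pow, hvx, map_mul, h2, hvy,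
      one_mul, one_mul, ← exp_nsmul, ← exp_sub]; rfl
  -- `L² ~ (9/4) x`: `(3x²/2y)² = (9/4) x · (x³ / y²)` and `x³ / y² ~ 1`
  have hL2 : v (L ^ 2 - 9 / 4 * x) < v (9 / 4 * x) := by
    have h3' : v (x ^ 3 / y ^ 2 - 1) < v (1 : F) := by
      have H := near_div (near_symm heq) (near_refl (v := v) (pow_ne_zero 2 hy0))
      rwa [div_self (pow_ne_zero _ hy0)] at H
    have h4' := near_mul (near_refl (mul_ne_zero (by norm_num : (9 / 4 : F) ≠ 0) hx0)) h3'
    rw [mul_one] at h4'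
    have e' : (3 * x ^ 2 / (2 * y)) ^ 2 = 9 / 4 * x * (x ^ 3 / y ^ 2) := by
      field_simp
      ring
    have h5 : v ((3 * x ^ 2 / (2 * y)) ^ 2 - 9 / 4 * x) < v (9 / 4 * x) := by rw [e']; exact h4'
    exact near_trans (near_pow hL 2) h5
  have h94x : v (9 / 4 * x) = exp 2 := by rw [map_mul, map_div₀, hvx, h9, h4]; simp
  have e : E.addX x x L = (L ^ 2 + (E.a₁ * L - E.a₂)) + (-2) * x := by simp only [Affine.addX]; ring
  have h1 : v (L ^ 2 + (E.a₁ * L - E.a₂) - 9 / 4 * x) < v (9 / 4 * x) := by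
    refine near_add_of_lt hL2 ?_
    rw [h94x]
    refine Valuation.map_sub_lt _ ?_ (ha₂.trans_lt (by rw [← exp_zero, exp_lt_exp]; norm_num))
    rw [map_mul, hvL]
    calc v E.a₁ * exp 1 ≤ 1 * exp 1 := mul_le_mul' ha₁ le_rfl
      _ < exp 2 := by rw [one_mul, exp_lt_exp]; norm_num
  have hc : (9 / 4 + -2 : F) = 1 / 4 := by norm_num
  rw [e, ← hc]
  refine near_add_smul h1 (near_refl (mul_ne_zero (by norm_num) hx0)) ?_ ?_ ?_
  · rw [map_div₀, h9, h4, div_one]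
  · rw [Valuation.map_neg, h2]
  · rw [hc, map_div₀, map_one, h4, div_one]

include hvx hvy ha₁ ha₃ hnat in
/-- **`y([2]P) ~ y/8`**: for `L ~ 3x²/2y` and `X₂ = addX x x L ~ x/4`,
`addY x x y L = -(L (X₂ - x) + y) - a₁ X₂ - a₃ ~ y/8`. [folklore] -/
theorem near_addY {L : F} (hL : v (L - 3 * x ^ 2 / (2 * y)) < v (3 * x ^ 2 / (2 * y)))
    (heq : v (y ^ 2 - x ^ 3) < v (x ^ 3))
    (hX₂ : v (E.addX x x L - 1 / 4 * x) < v (1 / 4 * x)) :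
    v (E.addY x x y L - 1 / 8 * y) < v (1 / 8 * y) := by
  have hx0 : x ≠ 0 := fun h ↦ by rw [h, map_zero] at hvx; exact exp_ne_zero hvx.symm
  have hy0 : y ≠ 0 := fun h ↦ by rw [h, map_zero] at hvy; exact exp_ne_zero hvy.symm
  have h3 : v (3 : F) = 1 := by exact_mod_cast hnat (n := 3) three_ne_zero
  have h4 : v (4 : F) = 1 := by exact_mod_cast hnat (n := 4) (by norm_num)
  have h8 : v (8 : F) = 1 := by exact_mod_cast hnat (n := 8) (by norm_num)
  have h9 : v (9 : F) = 1 := by exact_mod_cast hnat (n := 9) (by norm_num)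
  obtain ⟨X₂, hX₂_def⟩ : ∃ X₂, E.addX x x L = X₂ := ⟨_, rfl⟩
  rw [hX₂_def] at hX₂
  have hvX₂ : v X₂ = exp 2 := by
    rw [Valuation.map_eq_of_sub_lt _ hX₂, map_mul, map_div₀, map_one, h4, hvx]; simp
  have e : E.addY x x y L = -(L * (X₂ - x) + y) - (E.a₁ * X₂ + E.a₃) := by
    rw [← hX₂_def]; simp only [Affine.addY, Affine.negAddY, Affine.negY]; ring
  -- `X₂ - x ~ -(3/4) x`
  have h1 : v (X₂ - x - (-3 / 4) * x) < v ((-3 / 4) * x) := by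
    have hc : (1 / 4 + -1 : F) = -3 / 4 := by norm_num
    have h1' := near_add_smul hX₂ (near_refl (mul_ne_zero (by norm_num : (-1 : F) ≠ 0) hx0))
      (by rw [map_div₀, map_one, h4, div_one]) (by rw [Valuation.map_neg, map_one])
      (by rw [hc, map_div₀, Valuation.map_neg, h3, h4, div_one])
    rw [hc] at h1'
    have e' : X₂ - x = X₂ + (-1) * x := by ring
    rw [e']
    exact h1'
  -- `L (X₂ - x) ~ -(9/8) y`
  have h2' : v (L * (X₂ - x) - (-9 / 8) * y) < v ((-9 / 8) * y) := by
    have h4' : v (x ^ 3 / y - y) < v y := by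
      have H := near_div (near_symm heq) (near_refl (v := v) hy0)
      have ey : y ^ 2 / y = y := by field_simp
      rwa [ey] at H
    have h5 := near_mul (near_refl (by norm_num : (-9 / 8 : F) ≠ 0)) h4'
    have H := near_mul hL h1
    have e' : 3 * x ^ 2 / (2 * y) * (-3 / 4 * x) = -9 / 8 * (x ^ 3 / y) := by
      field_simp
      ring
    rw [e'] at H
    exact near_trans H h5
  -- `L (X₂ - x) + y ~ -(1/8) y`
  have h6 : v (L * (X₂ - x) + y - (-1 / 8) * y) < v ((-1 / 8) * y) := by
    have hc : (-9 / 8 + 1 : F) = -1 / 8 := by norm_num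
    have h6' := near_add_smul h2' (near_refl (by rw [one_mul]; exact hy0))
      (by rw [map_div₀, Valuation.map_neg, h9, h8, div_one]) (by rw [map_one])
      (by rw [hc, map_div₀, Valuation.map_neg, map_one, h8, div_one])
    rw [hc, one_mul] at h6'
    exact h6'
  have h7 : v (-(L * (X₂ - x) + y) - 1 / 8 * y) < v (1 / 8 * y) := by
    have H := near_neg h6
    have e' : -(-1 / 8 * y) = 1 / 8 * y := by ring
    rwa [e'] at H
  rw [e]
  refine near_sub_of_lt h7 ?_
  have h18y : v (1 / 8 * y) = exp 3 := by rw [map_mul, map_div₀, map_one, h8, hvy]; simp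
  rw [h18y]
  refine Valuation.map_add_lt _ ?_ (ha₃.trans_lt (by rw [← exp_zero, exp_lt_exp]; norm_num))
  rw [map_mul, hvX₂]
  calc v E.a₁ * exp 2 ≤ 1 * exp 2 := mul_le_mul' ha₁ le_rfl
    _ < exp 3 := by rw [one_mul, exp_lt_exp]; norm_num

include hvx hvy ha₁ ha₂ ha₃ ha₄ ha₆ hnat in
/-- **`(x/y)([2]P) ~ 2 · (x/y)`**: doubling multiplies the uniformiser `x/y` at `O` by `2` to
leading order (`L` is the tangent slope). [folklore] -/
theorem near_addX_div_addY (hE : E.Equation x y) {L : F}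
    (hLe : L = (3 * x ^ 2 + 2 * E.a₂ * x + E.a₄ - E.a₁ * y) / (y - E.negY x y)) :
    v (E.addX x x L / E.addY x x y L - 2 * (x / y)) < v (2 * (x / y)) := by
  have hx0 : x ≠ 0 := fun h ↦ by rw [h, map_zero] at hvx; exact exp_ne_zero hvx.symm
  have hy0 : y ≠ 0 := fun h ↦ by rw [h, map_zero] at hvy; exact exp_ne_zero hvy.symm
  have hL : v (L - 3 * x ^ 2 / (2 * y)) < v (3 * x ^ 2 / (2 * y)) :=
    hLe ▸ near_slope E v hvx hvy ha₁ ha₂ ha₃ ha₄ hnat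
  have heq := near_sq_cube E v hvx hvy ha₁ ha₂ ha₃ ha₄ ha₆ hE
  have hX₂ := near_addX E v hvx hvy ha₁ ha₂ hnat hL heq
  have hY₂ := near_addY E v hvx hvy ha₁ ha₃ hnat hL heq hX₂
  have H := near_div hX₂ hY₂
  have e' : 1 / 4 * x / (1 / 8 * y) = 2 * (x / y) := by
    field_simp
    norm_num
  rwa [e'] at H

end DoublingEstimates

/-! ## `[2]^* t ≡ 2 t (mod 𝔪_O²)` for `t = x/y` -/

section AtO

variable {K : Type u} [Field K] (W : WeierstrassCurve K) [W.IsElliptic]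

/-- **`[2]^* (x/y) ≡ 2 · (x/y) (mod 𝔪_O²)`**: the multiplier of the multiplication-by-`2` map at
`O` is `2` (and `[2]` is unramified at `O`). From the doubling formula over `K̄(E)`
(`([2]^* x, [2]^* y) = (x, y) + (x, y)`, the tree's `map_pullbackHom_zsmul_genericPoint`) and
`v_O (x) = exp 2`, `v_O (y) = exp 3` (`near_addX_div_addY`). Silverman, *AEC*, III.2.3(d)
(duplication formula), IV.§1 (`[2]` on the formal group: `[2](z) = 2z + …`). [folklore] -/
theorem placeVal_zero_pullbackHom_two_sub_le [CharZero K] :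
    W.placeVal 0 ((Isogeny.zsmul W 2 two_ne_zero).pullbackHom (W.genX / W.genY) -
      2 * (W.genX / W.genY)) ≤ exp (-2) := by
  haveI : CharZero W.geomFunctionField :=
    charZero_of_injective_algebraMap (algebraMap (AlgebraicClosure K) W.geomFunctionField).injective
  -- the valuation at `O` (made opaque) and the basic values
  obtain ⟨v, hv⟩ : ∃ v : Valuation W.geomFunctionField ℤᵐ⁰, W.placeVal 0 = v := ⟨_, rfl⟩
  haveI : v.IsTrivialOn (AlgebraicClosure K) := by rw [← hv]; infer_instance
  rw [hv]
  have hvx : v W.genX = exp 2 := by rw [← hv]; exact infValuationF_x _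
  have hvy : v W.genY = exp 3 := by rw [← hv]; exact infValuationF_y _
  have hvt : v (W.genX / W.genY) = exp (-1) := by rw [← hv]; exact infValuationF_x_div_y _
  have hnat : ∀ {n : ℕ}, n ≠ 0 → v (n : W.geomFunctionField) = 1 := fun hn ↦
    map_natCast_eq_one (AlgebraicClosure K) v hn
  have h2 : v (2 : W.geomFunctionField) = 1 := by exact_mod_cast hnat (n := 2) two_ne_zero
  have hcoef : ∀ a : K, v (algebraMap K W.geomFunctionField a) ≤ 1 := fun a ↦ by
    rw [IsScalarTower.algebraMap_apply K (AlgebraicClosure K) W.geomFunctionField]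
    exact Valuation.IsTrivialOn.valuation_algebraMap_le_one _ _
  have ha₁ : v (W.baseChange W.geomFunctionField).toAffine.a₁ ≤ 1 := hcoef W.a₁
  have ha₂ : v (W.baseChange W.geomFunctionField).toAffine.a₂ ≤ 1 := hcoef W.a₂
  have ha₃ : v (W.baseChange W.geomFunctionField).toAffine.a₃ ≤ 1 := hcoef W.a₃
  have ha₄ : v (W.baseChange W.geomFunctionField).toAffine.a₄ ≤ 1 := hcoef W.a₄
  have ha₆ : v (W.baseChange W.geomFunctionField).toAffine.a₆ ≤ 1 := hcoef W.a₆
  -- the doubling formula over `K̄(E)`: `([2]^* x, [2]^* y) = (x, y) + (x, y)`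
  have hneg : W.genY ≠ (W.baseChange W.geomFunctionField).toAffine.negY W.genX W.genY :=
    ne_negY_of_val _ v hvx hvy ha₁ ha₃ hnat
  have hgen := WeierstrassCurve.map_pullbackHom_zsmul_genericPoint (W := W) (m := 2) two_ne_zero
  rw [map_genericPoint, two_zsmul, genericPoint,
    Affine.Point.add_self_of_Y_ne (h₁ := nonsingular_genX_genY W) hneg] at hgen
  obtain ⟨hgx, hgy⟩ := Affine.Point.some.inj hgen
  rw [Affine.slope_of_Y_ne rfl hneg] at hgx hgy
  have hnear := near_addX_div_addY _ v hvx hvy ha₁ ha₂ ha₃ ha₄ ha₆ hnat (equation_genX_genY W) rfl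
  rw [← hgx, ← hgy, ← map_div₀] at hnear
  have h2t : v (2 * (W.genX / W.genY)) = exp (-1) := by rw [map_mul, h2, one_mul, hvt]
  rw [h2t] at hnear
  exact (lt_exp_iff_le_exp_sub_one (-1)).mp hnear

end AtO

/-! ## Isogenies `E → E` commute (Silverman, *AEC*, Cor. III.5.6(c)) -/

namespace Isogeny

variable {K : Type u} [Field K] {W W' : WeierstrassCurve K} [W.IsElliptic]

/-- **An isogeny is determined by its pull-back `φ^*` on function fields**: `φ^* = χ^*` forces
`φ = χ` (the values `x'(φ P) = (φ^* x')(P)`, `y'(φ P)` agree off a finite set, and homomorphisms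
agreeing off a finite subset of the infinite group `E(K̄)` are equal). Silverman, *AEC*, II.§2
(a rational map is determined by `φ^*`). [folklore] -/
theorem eq_of_pullbackHom_eq {φ χ : Isogeny W W'} (h : φ.pullbackHom = χ.pullbackHom) :
    φ = χ := by
  have hX : φ.pullbackX = χ.pullbackX := by rw [← pullbackHom_genX, h, pullbackHom_genX]
  have hY : φ.pullbackY = χ.pullbackY := by rw [← pullbackHom_genY, h, pullbackHom_genY]
  have key : ∀ P ∉ φ.badSet ∪ χ.badSet, φ P = χ P := by
    intro P hP
    simp only [Set.mem_union, not_or, badSet, Set.mem_setOf_eq, not_not] at hP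
    obtain ⟨hφ, hχ⟩ := hP
    have hP0 : P ≠ 0 := (agreesWithRationalMapAt_iff.mp hφ).1
    obtain ⟨_, _, _, h₁', e₁⟩ := agreesWithRationalMapAt_iff.mp hφ
    obtain ⟨_, _, _, h₂', e₂⟩ := agreesWithRationalMapAt_iff.mp hχ
    have hφ0 : φ P ≠ 0 := by rw [e₁]; exact Affine.Point.some_ne_zero _
    have hχ0 : χ P ≠ 0 := by rw [e₂]; exact Affine.Point.some_ne_zero _
    refine eq_of_xy_eq hφ0 hχ0 (funext fun i ↦ ?_)
    have v₁ := φ.hasValueAt_pullback_gen hφ i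
    have v₂ := χ.hasValueAt_pullback_gen hχ i
    fin_cases i
    · simp only [Fin.zero_eta, Matrix.cons_val_zero] at v₁ v₂
      rw [hX] at v₁
      exact v₁.unique hP0 v₂
    · simp only [Fin.mk_one, Matrix.cons_val_one, Matrix.cons_val_zero] at v₁ v₂
      rw [hY] at v₁
      exact v₁.unique hP0 v₂
  have hfin : (φ.badSet ∪ χ.badSet).Finite := φ.finite_badSet'.union χ.finite_badSet'
  have := Literature.NumberTheory.EllipticCurves.AddMonoidHom.eq_of_eqOn_compl_finite
    (f := φ.toAddMonoidHom) (g := χ.toAddMonoidHom) hfin key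
  exact Isogeny.ext fun P ↦ DFunLike.congr_fun this P

/-- `χ ∘ [m] = [m] ∘ χ`: an isogeny is a homomorphism. Silverman, *AEC*, Thm. III.4.8.
[folklore] -/
theorem comp_zsmul_eq (χ : Isogeny W W) {m : ℤ} (hm : m ≠ 0) :
    χ.comp (Isogeny.zsmul W m hm) = (Isogeny.zsmul W m hm).comp χ :=
  Isogeny.ext fun P ↦ by simp [map_zsmul]

/-- `χ^* ∘ [m]^* = [m]^* ∘ χ^*` on `K̄(E)`. [folklore] -/
theorem pullbackHom_zsmul_comm (χ : Isogeny W W) {m : ℤ} (hm : m ≠ 0) (u : W.geomFunctionField) :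
    χ.pullbackHom ((Isogeny.zsmul W m hm).pullbackHom u) =
      (Isogeny.zsmul W m hm).pullbackHom (χ.pullbackHom u) := by
  have h1 := pullbackHom_comp χ (Isogeny.zsmul W m hm)
  have h2 := pullbackHom_comp (Isogeny.zsmul W m hm) χ
  rw [comp_zsmul_eq χ hm] at h1
  exact (AlgHom.congr_fun (h1.symm.trans h2) u).symm

/-- **`φ^*` is contracting for `v_O`**: `v_O (φ^* u) = v_O (u) ^ e ≤ v_O u` when `v_O u ≤ 1`
(`φ O = O`; the tree's `Isogeny.placeVal_pullbackHom`). Silverman, *AEC*, II.§2 (`e_φ(P)`).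
[folklore] -/
theorem placeVal_zero_pullbackHom_le (φ : Isogeny W W) {u : W.geomFunctionField}
    (hu : W.placeVal 0 u ≤ 1) : W.placeVal 0 (φ.pullbackHom u) ≤ W.placeVal 0 u := by
  rw [placeVal_pullbackHom, map_zero]
  obtain ⟨e, he⟩ : ∃ e, φ.ramificationIndex 0 = e + 1 :=
    ⟨φ.ramificationIndex 0 - 1, (Nat.sub_add_cancel (φ.ramificationIndex_pos 0)).symm⟩
  rw [he, pow_succ]
  exact mul_le_of_le_one_left' (pow_le_one' hu _)

/-- **Isogenies `E → E` commute** (characteristic `0`): `φ ∘ ψ = ψ ∘ φ` for all isogenies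
`φ, ψ : E → E` over `K`; this is the commutativity of `End(E)`, Silverman, *AEC*, Cor. III.5.6(c)
("If `char(K) = 0`, then `End(E)` is a commutative ring"). Proved by formal linearisation at `O`
(see the module docstring): `(φ ∘ ψ)^*` and `(ψ ∘ φ)^*` are contracting endomorphisms of `K̄(E)`
for `v_O` which commute with `[2]^*`, agree modulo `𝔪_O²` on `t = x/y` (both `≡ a_φ a_ψ t`), and
`[2]^* t ≡ 2t (mod 𝔪_O²)` (`placeVal_zero_pullbackHom_two_sub_le`); by the local centraliser
lemma (`map_t_eq_of_commute`, where `2ⁿ ≠ 2` uses characteristic `0`) they agree on `t`, hence on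
`K̄(E)` (`algHom_ext_of_map_t_eq`), hence `φ ∘ ψ = ψ ∘ φ` (`eq_of_pullbackHom_eq`).
[cite: SilvermanAEC2009, Cor. III.5.6(c)] -/
theorem comp_comm [CharZero K] (φ ψ : Isogeny W W) : φ.comp ψ = ψ.comp φ := by
  apply eq_of_pullbackHom_eq
  -- the local data at `O`
  have ht : W.placeVal 0 (W.genX / W.genY) = exp (-1) := infValuationF_x_div_y _
  have hres : ∀ u, W.placeVal 0 u ≤ 1 → ∃ c : AlgebraicClosure K,
      W.placeVal 0 (u - algebraMap _ W.geomFunctionField c) < 1 :=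
    fun u hu ↦ exists_placeValuation_sub_lt_one 0 hu
  have hle1 : (exp (-1) : ℤᵐ⁰) ≤ 1 := by rw [← exp_zero, exp_le_exp]; decide
  -- the three contracting endomorphisms `(φ ∘ ψ)^* = ψ^* ∘ φ^*`, `(ψ ∘ φ)^*`, `[2]^*`
  have hφ : ∀ u, W.placeVal 0 u ≤ 1 → W.placeVal 0 (φ.pullbackHom u) ≤ W.placeVal 0 u :=
    fun _ hu ↦ φ.placeVal_zero_pullbackHom_le hu
  have hψ : ∀ u, W.placeVal 0 u ≤ 1 → W.placeVal 0 (ψ.pullbackHom u) ≤ W.placeVal 0 u :=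
    fun _ hu ↦ ψ.placeVal_zero_pullbackHom_le hu
  have h2 : ∀ u, W.placeVal 0 u ≤ 1 →
      W.placeVal 0 ((Isogeny.zsmul W 2 two_ne_zero).pullbackHom u) ≤ W.placeVal 0 u :=
    fun _ hu ↦ (Isogeny.zsmul W 2 two_ne_zero).placeVal_zero_pullbackHom_le hu
  have hγ₁ : ∀ u, W.placeVal 0 u ≤ 1 → W.placeVal 0 ((φ.comp ψ).pullbackHom u) ≤ W.placeVal 0 u :=
    fun u hu ↦ by
      rw [pullbackHom_comp, AlgHom.comp_apply]; exact ((hψ _ ((hφ u hu).trans hu)).trans (hφ u hu))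
  have hγ₂ : ∀ u, W.placeVal 0 u ≤ 1 → W.placeVal 0 ((ψ.comp φ).pullbackHom u) ≤ W.placeVal 0 u :=
    fun u hu ↦ by
      rw [pullbackHom_comp, AlgHom.comp_apply]; exact ((hφ _ ((hψ u hu).trans hu)).trans (hψ u hu))
  -- `φ^* t ≡ a t`, `ψ^* t ≡ b t (mod 𝔪²)`, so both composites are `≡ ab t`
  obtain ⟨a, ha⟩ := exists_sub_const_mul_pow_le ht hres (n := 1)
    (u := φ.pullbackHom (W.genX / W.genY))
    (by rw [Nat.cast_one]; exact map_le_of_contracting hφ ht.le hle1)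
  obtain ⟨b, hb⟩ := exists_sub_const_mul_pow_le ht hres (n := 1)
    (u := ψ.pullbackHom (W.genX / W.genY))
    (by rw [Nat.cast_one]; exact map_le_of_contracting hψ ht.le hle1)
  rw [pow_one] at ha hb
  have hexp : exp (-((1 + 1 : ℕ) : ℤ)) = (exp (-2) : ℤᵐ⁰) := rfl
  rw [hexp] at ha hb
  have hva : W.placeVal 0 (algebraMap _ W.geomFunctionField a) ≤ 1 :=
    Valuation.IsTrivialOn.valuation_algebraMap_le_one _ _
  have hvb : W.placeVal 0 (algebraMap _ W.geomFunctionField b) ≤ 1 :=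
    Valuation.IsTrivialOn.valuation_algebraMap_le_one _ _
  have key : ∀ {χ₁ χ₂ : Isogeny W W} {c₁ c₂ : AlgebraicClosure K},
      (∀ u, W.placeVal 0 u ≤ 1 → W.placeVal 0 (χ₂.pullbackHom u) ≤ W.placeVal 0 u) →
      W.placeVal 0 (χ₁.pullbackHom (W.genX / W.genY) -
        algebraMap _ W.geomFunctionField c₁ * (W.genX / W.genY)) ≤ exp (-2) →
      W.placeVal 0 (χ₂.pullbackHom (W.genX / W.genY) -
        algebraMap _ W.geomFunctionField c₂ * (W.genX / W.genY)) ≤ exp (-2) →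
      W.placeVal 0 (algebraMap _ W.geomFunctionField c₁) ≤ 1 →
      W.placeVal 0 ((χ₁.comp χ₂).pullbackHom (W.genX / W.genY) -
        algebraMap _ W.geomFunctionField (c₁ * c₂) * (W.genX / W.genY)) ≤ exp (-2) := by
    intro χ₁ χ₂ c₁ c₂ hχ₂ h₁ h₂ hc₁
    have e : (χ₁.comp χ₂).pullbackHom (W.genX / W.genY) -
        algebraMap _ W.geomFunctionField (c₁ * c₂) * (W.genX / W.genY) =
        χ₂.pullbackHom (χ₁.pullbackHom (W.genX / W.genY) -
          algebraMap _ W.geomFunctionField c₁ * (W.genX / W.genY)) +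
        algebraMap _ W.geomFunctionField c₁ * (χ₂.pullbackHom (W.genX / W.genY) -
          algebraMap _ W.geomFunctionField c₂ * (W.genX / W.genY)) := by
      rw [pullbackHom_comp, AlgHom.comp_apply]
      simp only [map_sub, map_mul, AlgHom.commutes]
      ring
    rw [e]
    refine Valuation.map_add_le _
      (map_le_of_contracting hχ₂ h₁ (by rw [← exp_zero, exp_le_exp]; decide)) ?_
    rw [map_mul]
    exact mul_le_of_le_one_of_le hc₁ h₂
  have h12 : W.placeVal 0 ((φ.comp ψ).pullbackHom (W.genX / W.genY) -
      (ψ.comp φ).pullbackHom (W.genX / W.genY)) ≤ exp (-2) := by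
    have e : (φ.comp ψ).pullbackHom (W.genX / W.genY) - (ψ.comp φ).pullbackHom (W.genX / W.genY) =
        ((φ.comp ψ).pullbackHom (W.genX / W.genY) -
          algebraMap _ W.geomFunctionField (a * b) * (W.genX / W.genY)) -
        ((ψ.comp φ).pullbackHom (W.genX / W.genY) -
          algebraMap _ W.geomFunctionField (b * a) * (W.genX / W.genY)) := by
      rw [mul_comm b a]; ring
    rw [e]
    exact Valuation.map_sub_le _ (key hψ ha hb hva) (key hφ hb ha hvb)
  -- the centraliser lemma
  have hcomm₁ := (φ.comp ψ).pullbackHom_zsmul_comm (two_ne_zero (α := ℤ))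
  have hcomm₂ := (ψ.comp φ).pullbackHom_zsmul_comm (two_ne_zero (α := ℤ))
  have hδt := placeVal_zero_pullbackHom_two_sub_le W
  have ht_eq := map_t_eq_of_commute ht hres hγ₁ hγ₂ h2 hcomm₁ hcomm₂ hδt h12
  exact algHom_ext_of_map_t_eq ht hres hγ₁ hγ₂ ht_eq

/-- **Isogenies `E → E` commute pointwise**: `φ (ψ P) = ψ (φ P)` (characteristic `0`).
[cite: SilvermanAEC2009, Cor. III.5.6(c)] -/
theorem comp_apply_comm [CharZero K] (φ ψ : Isogeny W W) (P : W.geomPoints) : φ (ψ P) = ψ (φ P) := by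
  have := congrArg (fun χ : Isogeny W W ↦ χ P) (comp_comm φ ψ)
  simpa using this

end Isogeny

/-! ## `End_{K̄}(E)` is commutative in characteristic `0`

An algebraic additive endomorphism of `E(K̄)` need not be defined over `K`; read over the base
field `K̄` — whose absolute Galois group acts trivially on the `K̄̄`-points, `K̄̄ := AlgebraicClosure K̄`
being `K̄` again — it is an isogeny of `E_{K̄} = W.baseChange K̄` in the prelude's sense, to which
`Isogeny.comp_apply_comm` applies. -/

section Transport

variable {K : Type u} [Field K] {W : WeierstrassCurve K}

/-- The `K̄`-automorphisms of `K̄̄` are trivial (`K̄ → K̄̄` is onto, Mathlib's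
`IsSepClosed.algebraMap_surjective`). [folklore] -/
theorem algEquiv_algebraicClosure_apply
    (σ : AlgebraicClosure (AlgebraicClosure K) ≃ₐ[AlgebraicClosure K] AlgebraicClosure (AlgebraicClosure K))
    (u : AlgebraicClosure (AlgebraicClosure K)) : σ u = u := by
  obtain ⟨x, rfl⟩ := IsSepClosed.algebraMap_surjective (AlgebraicClosure K) (AlgebraicClosure (AlgebraicClosure K)) u
  exact σ.commutes x

/-- The absolute Galois group of `K̄` acts trivially on `E_{K̄}(K̄̄)`. [folklore] -/
theorem absoluteGaloisGroup_smul_eq_self (σ : Field.absoluteGaloisGroup (AlgebraicClosure K))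
    (Q : (W.baseChange (AlgebraicClosure K)).geomPoints) : σ • Q = Q := by
  let σ' : AlgebraicClosure (AlgebraicClosure K) ≃ₐ[AlgebraicClosure K]
    AlgebraicClosure (AlgebraicClosure K) := σ
  change Affine.Point.map (W' := W.baseChange (AlgebraicClosure K))
    (σ' : AlgebraicClosure (AlgebraicClosure K) →ₐ[AlgebraicClosure K]
      AlgebraicClosure (AlgebraicClosure K)) Q = Q
  cases Q with
  | zero => rfl
  | some u w h =>
    rw [Affine.Point.map_some]
    exact Affine.Point.some.congr_simp _ _ (algEquiv_algebraicClosure_apply σ' u) _ _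
      (algEquiv_algebraicClosure_apply σ' w) _

/-- The base change of points `E(K̄) → E_{K̄}(K̄̄)` along `K̄ → K̄̄` (Mathlib's `Affine.Point.map`)
is onto. [folklore] -/
theorem map_ofId_algebraicClosure_surjective :
    Function.Surjective (Affine.Point.map (W' := W)
      (Algebra.ofId (AlgebraicClosure K) (AlgebraicClosure (AlgebraicClosure K))) :
        W.geomPoints → (W.baseChange (AlgebraicClosure K)).geomPoints) := by
  intro Q
  cases Q with
  | zero => exact ⟨0, rfl⟩
  | some u w h =>
    obtain ⟨x, rfl⟩ := IsSepClosed.algebraMap_surjective (AlgebraicClosure K) (AlgebraicClosure (AlgebraicClosure K)) u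
    obtain ⟨y, rfl⟩ :=
      IsSepClosed.algebraMap_surjective (AlgebraicClosure K) (AlgebraicClosure (AlgebraicClosure K)) w
    exact ⟨.some x y ((Affine.baseChange_nonsingular (W := W) (f := Algebra.ofId _ _)
      (FaithfulSMul.algebraMap_injective _ _) x y).mp h), rfl⟩

/-- Evaluation of two-variable polynomials commutes with `K̄ → K̄̄` applied to coefficients and
arguments. [folklore] -/
theorem eval_map_algebraMap_algebraicClosure (p : MvPolynomial (Fin 2) (AlgebraicClosure K)) (x y : AlgebraicClosure K) :
    MvPolynomial.eval ![algebraMap _ (AlgebraicClosure (AlgebraicClosure K)) x,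
        algebraMap _ (AlgebraicClosure (AlgebraicClosure K)) y]
      (MvPolynomial.map (algebraMap _ (AlgebraicClosure (AlgebraicClosure K))) p) =
    algebraMap _ (AlgebraicClosure (AlgebraicClosure K)) (MvPolynomial.eval ![x, y] p) := by
  rw [MvPolynomial.eval_map,
    show MvPolynomial.eval ![x, y] p = MvPolynomial.eval₂ (RingHom.id _) ![x, y] p from rfl,
    MvPolynomial.eval₂_comp_left, RingHom.comp_id]
  congr 1
  funext i
  fin_cases i <;> rfl

/-- **An algebraic additive endomorphism of `E(K̄)`, transported along `E(K̄) ≃ E_{K̄}(K̄̄)`, is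
algebraic** (with the same rational map, coefficients read in `K̄̄`): for any additive
equivalence `β` given by the base change of points. [folklore] -/
theorem isAlgebraicOn_conj (β : W.geomPoints ≃+ (W.baseChange (AlgebraicClosure K)).geomPoints)
    (hβ : ∀ P, β P = Affine.Point.map (W' := W)
      (Algebra.ofId (AlgebraicClosure K) (AlgebraicClosure (AlgebraicClosure K))) P)
    {f : W.geomPoints →+ W.geomPoints} (hf : IsAlgebraicOn W W f) :
    IsAlgebraicOn (W.baseChange (AlgebraicClosure K)) (W.baseChange (AlgebraicClosure K))
      ((β.toAddMonoidHom.comp f).comp β.symm.toAddMonoidHom) := by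
  obtain ⟨P₁, Q₁, P₂, Q₂, hfin⟩ := hf
  refine ⟨P₁.map (algebraMap _ (AlgebraicClosure (AlgebraicClosure K))),
    Q₁.map (algebraMap _ (AlgebraicClosure (AlgebraicClosure K))),
    P₂.map (algebraMap _ (AlgebraicClosure (AlgebraicClosure K))),
    Q₂.map (algebraMap _ (AlgebraicClosure (AlgebraicClosure K))), ?_⟩
  refine (hfin.image β).subset fun Q hQ ↦ ?_
  obtain ⟨P, rfl⟩ := β.surjective Q
  refine ⟨P, fun hP ↦ hQ ?_, rfl⟩
  -- transport the agreement at `P` to `β P`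
  obtain ⟨x, y, h, rfl, hQ₁, hQ₂, h', hfP⟩ := hP
  have hx' : MvPolynomial.eval ![algebraMap _ (AlgebraicClosure (AlgebraicClosure K)) x,
        algebraMap _ (AlgebraicClosure (AlgebraicClosure K)) y]
        (P₁.map (algebraMap _ (AlgebraicClosure (AlgebraicClosure K)))) /
      MvPolynomial.eval ![algebraMap _ (AlgebraicClosure (AlgebraicClosure K)) x,
        algebraMap _ (AlgebraicClosure (AlgebraicClosure K)) y]
        (Q₁.map (algebraMap _ (AlgebraicClosure (AlgebraicClosure K)))) =
      algebraMap _ (AlgebraicClosure (AlgebraicClosure K))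
        (MvPolynomial.eval ![x, y] P₁ / MvPolynomial.eval ![x, y] Q₁) := by
    rw [eval_map_algebraMap_algebraicClosure, eval_map_algebraMap_algebraicClosure, map_div₀]
  have hy' : MvPolynomial.eval ![algebraMap _ (AlgebraicClosure (AlgebraicClosure K)) x,
        algebraMap _ (AlgebraicClosure (AlgebraicClosure K)) y]
        (P₂.map (algebraMap _ (AlgebraicClosure (AlgebraicClosure K)))) /
      MvPolynomial.eval ![algebraMap _ (AlgebraicClosure (AlgebraicClosure K)) x,
        algebraMap _ (AlgebraicClosure (AlgebraicClosure K)) y]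
        (Q₂.map (algebraMap _ (AlgebraicClosure (AlgebraicClosure K)))) =
      algebraMap _ (AlgebraicClosure (AlgebraicClosure K))
        (MvPolynomial.eval ![x, y] P₂ / MvPolynomial.eval ![x, y] Q₂) := by
    rw [eval_map_algebraMap_algebraicClosure, eval_map_algebraMap_algebraicClosure, map_div₀]
  have hβP : β (.some x y h) = .some (algebraMap _ _ x) (algebraMap _ _ y)
      ((Affine.baseChange_nonsingular (W := W) (f := Algebra.ofId _ _)
        (FaithfulSMul.algebraMap_injective _ _) x y).mpr h) := by
    rw [hβ]; rfl
  refine ⟨_, _, _, hβP, ?_, ?_, ?_⟩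
  · rw [eval_map_algebraMap_algebraicClosure]; exact (_root_.map_ne_zero _).mpr hQ₁
  · rw [eval_map_algebraMap_algebraicClosure]; exact (_root_.map_ne_zero _).mpr hQ₂
  · refine ⟨?_, ?_⟩
    · rw [hx', hy']
      exact (Affine.baseChange_nonsingular (W := W) (f := Algebra.ofId _ _)
        (FaithfulSMul.algebraMap_injective _ _) _ _).mpr h'
    · rw [AddMonoidHom.comp_apply, AddMonoidHom.comp_apply, AddEquiv.coe_toAddMonoidHom,
        AddEquiv.coe_toAddMonoidHom, AddEquiv.symm_apply_apply, hfP, hβ, Affine.Point.map_some]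
      exact Affine.Point.some.congr_simp _ _ hx'.symm _ _ hy'.symm _

/-- **Algebraic additive endomorphisms of `E(K̄)` commute** (characteristic `0`): transported
along `E(K̄) ≃ E_{K̄}(K̄̄)` they are isogenies of `E_{K̄}` over `K̄` (algebraic by
`isAlgebraicOn_conj`, `Gal(K̄̄/K̄)`-equivariant because that group acts trivially, of finite kernel
because algebraic), which commute by `Isogeny.comp_apply_comm`.
[cite: SilvermanAEC2009, Cor. III.5.6(c)] -/
theorem IsAlgebraicOn.comp_comm [CharZero K] [W.IsElliptic] {f g : W.geomPoints →+ W.geomPoints}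
    (hf : IsAlgebraicOn W W f) (hg : IsAlgebraicOn W W g) (P : W.geomPoints) : f (g P) = g (f P) := by
  -- the bijection `β : E(K̄) ≃ E_{K̄}(K̄̄)`
  have hinj := Affine.Point.map_injective (W' := W)
    (Algebra.ofId (AlgebraicClosure K) (AlgebraicClosure (AlgebraicClosure K)))
  let β : W.geomPoints ≃+ (W.baseChange (AlgebraicClosure K)).geomPoints :=
    AddEquiv.ofBijective _ ⟨hinj, map_ofId_algebraicClosure_surjective⟩
  have hβ : ∀ P, β P = Affine.Point.map (W' := W)
      (Algebra.ofId (AlgebraicClosure K) (AlgebraicClosure (AlgebraicClosure K))) P := fun _ ↦ rfl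
  -- the transported isogenies of `E_{K̄}` over `K̄`
  let lift : ∀ {e : W.geomPoints →+ W.geomPoints}, IsAlgebraicOn W W e →
      Isogeny (W.baseChange (AlgebraicClosure K)) (W.baseChange (AlgebraicClosure K)) :=
    fun {e} he ↦
      { toAddMonoidHom := (β.toAddMonoidHom.comp e).comp β.symm.toAddMonoidHom
        isAlgebraic := isAlgebraicOn_conj β hβ he
        equivariant := fun σ Q ↦ by
          rw [absoluteGaloisGroup_smul_eq_self, absoluteGaloisGroup_smul_eq_self]
        finite_ker := IsAlgebraicOn.finite_ker (isAlgebraicOn_conj β hβ he) }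
  have hlift : ∀ {e : W.geomPoints →+ W.geomPoints} (he : IsAlgebraicOn W W e) (P : W.geomPoints),
      lift he (β P) = β (e P) := fun he P ↦ by
    change β (_ ) = _
    rw [AddEquiv.coe_toAddMonoidHom, AddEquiv.symm_apply_apply]
  apply β.injective
  have h := Isogeny.comp_apply_comm (lift hf) (lift hg) (β P)
  rwa [hlift hg, hlift hf, hlift hf, hlift hg] at h

variable (W) in
/-- **Discharge of the named fact `WeierstrassCurve.geomEndRing_comm`** (`Isogeny.lean`): in
characteristic `0` the geometric endomorphism ring `End_{K̄}(E) = W.geomEndRing` of an elliptic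
curve is commutative — Silverman, *AEC*, Cor. III.5.6(c) ("If `char(K) = 0`, then `End(E)` is a
commutative ring"; whence `End(E)` is `ℤ` or an order in an imaginary quadratic field,
Cor. III.9.4, Remark III.9.4.1). `W.geomEndRing` is the subring of `AddMonoid.End E(K̄)` generated
by the algebraic endomorphisms; these commute pairwise (`IsAlgebraicOn.comp_comm`), and the subring
generated by a pairwise commuting set is commutative (`Subring.isMulCommutative_closure`).
[cite: SilvermanAEC2009, Cor. III.5.6(c)] -/
theorem geomEndRing_comm_holds : W.geomEndRing_comm := by
  intro _ _ φ ψ hφ hψ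
  have hcomm : ∀ f ∈ {φ : AddMonoid.End W.geomPoints | IsAlgebraicOn W W φ},
      ∀ g ∈ {φ : AddMonoid.End W.geomPoints | IsAlgebraicOn W W φ}, f * g = g * f :=
    fun f hf g hg ↦ AddMonoidHom.ext fun P ↦ IsAlgebraicOn.comp_comm hf hg P
  have h := (Subring.isMulCommutative_closure hcomm).is_comm.comm
    (⟨φ, hφ⟩ : Subring.closure {φ : AddMonoid.End W.geomPoints | IsAlgebraicOn W W φ}) ⟨ψ, hψ⟩
  exact congrArg Subtype.val h

end Transport

end WeierstrassCurve
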